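import Summits.ValiantsHypothesis.ValiantsHypothesis.Theses.WsBorderSandwich

/-!
# `WsBorderSandwich.Assembly` holds (bookkeeping item 23470 closed by proof)

The assembly item of route `WsBorderSandwich` (decomp-valiant workshop, lens 1) reads
«`VP ℂ = VNP ℂ` ⟹ the permanent family `(perPoly (Fin n) ℂ)_n` is a `VP` family».  It is
provable outright: `per ∈ VNP` (Valiant 1979; tree `perFamily_mem_VNP_holds`) unbundled along the
tree's bridge `mem_VP_ofFintype_iff_holds` — exactly the proof recorded in the lens-1 planner's
sketch (`HOME/decomp-val-lens-1/WsBorderSandwich.sketch.lean`, `example : Assembly`).  The workshop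
critic ruled (bus 527, 2026-08-30T07:57:31Z, consequence (i) of the cross-lens kernel
`Theorems/VPBoundarySquareWsSandwich.lean`, whose `valiant_of_sandwich : A → B → S` makes the item
redundant in `closes`) that no decorative item may remain open: «close it by proof (it is
provable-now bookkeeping) or drop it».  This file does the former; it changes no tag and no rung.
-/

set_option linter.dupNamespace false

namespace Summit.ValiantsHypothesis.ValiantsHypothesis.Theorems.WsBorderSandwichAssembly

open Literature.Computability.AlgebraicComplexity

/-- **Item 23470 (`WsBorderSandwich.Assembly`) holds**: under `VP ℂ = VNP ℂ` the permanent family is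
a `VP` family, because it is a `VNP` family (Valiant 1979, `perFamily_mem_VNP_holds`) and the bundled
classes agree. [cite: Valiant1979, Thm. 1 (per ∈ VNP); Burgisser2000, Ch. 2] -/
theorem assembly_holds :
    Summit.ValiantsHypothesis.ValiantsHypothesis.Theses.WsBorderSandwich.Assembly := fun hEq =>
  (mem_VP_ofFintype_iff_holds (k := ℂ) (σ := fun n => Fin n × Fin n) _).1
    (by rw [hEq]; exact perFamily_mem_VNP_holds ℂ)

end Summit.ValiantsHypothesis.ValiantsHypothesis.Theorems.WsBorderSandwichAssembly
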